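import Summits.QuantumFields.YangMills.Theorems.BalabanUVNodesK0V23Stub3BoxSuppliersAx
import Summits.QuantumFields.YangMills.Theorems.BalabanUVNodesK0Stub3FinVolPeriodicity

/-!
# K0ᴬ (stmt-QuantumFields-27238 `Record13SepCoPHInhabitedAx`) — NODE O's box in the FINITE-VOLUME CURRENCIES, RE-CENTRED (H3.3 Ax edition of `…K0V23Stub3FinVolSuppliers`): W1's box
# limit letter (1.21) + ONE pair `(C, δ₁)` bounding the windowed finite-torus kernels of the RE-CENTRED merged term of record EVENTUALLY in `K` ∕ on every FUNDAMENTAL WINDOW ∕ in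
# weighted-moment form ⟹ `|β₁₃ᴬˣ(θ)| ≤ β′` on `]0, γ₀]`; at the re-centred print-regime Z3 window members each gives the TOKEN-FREE CORE of the REGISTERED V24 stub-3ᴬ′ᴮ text

Cell `pub-ymgap` (YM-PLAN Track A, D-0062), width seat `pub-ymgap-dag-n07-w3` (g23; helper strictly BELOW the registered |β|-box stub).  `--kind proof --supports stmt-QuantumFields-27238
--as helper` (K0ᴬ), COUNT-NEUTRAL.  NEW leaf; theorems only — 0 `def`, 0 `sorry`, 0 `instance`, 0 `notation`; standard axioms.  σ-IMAGE of dag-n07-w3 g16's ✓p771057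
`…K0V23Stub3FinVolSuppliers` (body-freeze: nothing of it edited) under director-ym №467 (D)'s substitution (`betaOfRecord₁₃ ↦ betaOfRecord₁₃Ax`, `chiβOfRecord₁₃ θ ↦ chiβOfRecord₁₃Ax θ`
in the merged term family, `theta13OfThm1CCMWZB ↦ theta13OfThm1CCMWZBAx`); k0-s3-w2's CENTRED unfolding `K0Stub3FinVolPeriodicity.betaOfRecord₁₃_eq_secondMoment_of_mem` is re-issued
here at Ax (`betaOfRecord₁₃Ax_eq_secondMoment_of_mem`, two lines over `Record13Ax.betaOfRecord₁₃Ax_eq_betaOfRecord₈Tχ`); its centre-free `sitesPerDir_tendsto_atTop ∕ box_mono_of_le` and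
this seat's CLAIM-4 window edition `K0V23Stub3BoxSuppliersAx.tokenFreeZBAx_of_windowBoxAtZB` are used BY NAME; every other proof is the bare file's, one token changed.
[I] = [Balaban1987RG1]; [II] = [Balaban1989LargeFieldII].

CONTENTS.  §1 private verbatim helpers (R1)∕(R2)∕(R1′)∕(R2′) (centre-free: limits inherit eventual bounds; fundamental-domain ⟹ eventual; the tori grow); §2 θ-generic suppliers at the
RE-CENTRED record in |·|-form (`abs_betaOfRecord₁₃Ax_le_of_uniformEventualDecayOnBox`, `…_of_fundamentalDomainDecayOnBox`, `…_of_eventualAbsMomentOnBox`,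
`…_of_fundamentalDomainAbsMomentOnBox`) on a window `γ₀ ≤ θ.γ` with W1's GENERIC box limit letter `PolLimitsExistBox` at the re-centred term family (= ✓p811021
`PolLimitsExistBoxOfRecord₁₃Ax θ` when `γ₀ = θ.γ`, `Iff.rfl`); §3 at the RE-CENTRED print-regime Z3 window members, per radius ⟹ the token-free core of ✓p807776 `…K0V23Stub3SocketsAx`
(`tokenFreeZBAx_of_fundamentalDomainFaceAtZB`, `tokenFreeZBAx_of_uniformEventualFaceAtZB`, `tokenFreeZBAx_of_momentFaceAtZB`).

HONEST FRAMING (binding).  Real bookkeeping (`le_of_tendsto`, `tendsto_finsetSum`, `summable_of_sum_le`) + by-name composition; every finite-volume bound and the (1.21) box letter is a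
HYPOTHESIS (NODE O's torus analysis, [I] (1.7) ∕ §5 (5.10) p.293 — inhabited nowhere here); NO β estimate; the token-free core ∕ stub 3ᴬ′ᴮ NOT proved ([I] §1 p.264 «uniformly
bounded» STATED, proof unpublished [II] p.355); K0ᴬ stmt-QuantumFields-27238 NOT closed; K1ᴬ ∕ K3ᴬ OPEN; K0⁷ 20541 aside, untouched; N07 NOT discharged; counts UNMOVED (typed 28∕28 ·
discharged 8∕28; K 1∕4); R4 = the CONDITIONAL finite-𝕋⁴ rung `BalabanLadder.UV` at fixed `ε = L^(−K)` only — NOT continuum ∕ ℝ⁴ ∕ OS; the Yang–Mills mass gap (Clay) is NOT proved by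
any of this.
-/

noncomputable section

open Filter Topology
open scoped BigOperators Matrix.Norms.L2Operator

namespace Summit.QuantumFields.YangMills.Theorems.K0V23Stub3FinVolSuppliersAx

open Literature.MathematicalPhysics.QuantumFieldTheory.Balaban1983to89
open Literature.MathematicalPhysics.QuantumFieldTheory.Balaban1983to89.Node00
open Literature.MathematicalPhysics.QuantumFieldTheory.Balaban1983to89.T4Continuum
open Literature.MathematicalPhysics.QuantumFieldTheory.Balaban1983to89.FlowStep
open Literature.MathematicalPhysics.QuantumFieldTheory.Balaban1983to89.B12Sec2to5 (Decay510 l1 betaPrime510 secondMoment_abs_le_of_decay510)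
open Literature.MathematicalPhysics.QuantumFieldTheory.Balaban1983to89.Node00.U3KernelLetters (PolLimitsExistBox)
open Summit.QuantumFields.YangMills.Theorems.K0Stub3FinVolPeriodicity (sitesPerDir_tendsto_atTop box_mono_of_le)
open Summit.QuantumFields.YangMills.Theorems.K0V23Stub3BoxSuppliersAx (tokenFreeZBAx_of_windowBoxAtZB)

/-! ## §1  Private helpers — the REPAIRED finite-volume currencies and what they give for the LIMITING kernel (k0-s3-w2's (R1)∕(R2)∕(R1′)∕(R2′), re-homed verbatim; №366 R2) -/

section Repair

variable {𝔄 : Type*} [NormedRing 𝔄] [NormedAlgebra ℝ 𝔄]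
variable {V : Type*} [NormedAddCommGroup V] [NormedSpace ℝ V] {ι : Type*} [Fintype ι]

/-- (R1) limits inherit eventual pointwise decay. [cite: Balaban1987RG1, (1.21) p.264 and (5.10) p.293] -/
private theorem decay510_polLimit_of_eventually (F : T4Family) (j : ℕ) (ℰ : (K : ℕ) → (Fin (F.P K).d → Site (F.P K) j → 𝔄) → ℝ)
    (ρ : V →L[ℝ] 𝔄) (bV : Module.Basis ι ℝ V) (μ ν : Fin 4) {C δ₁ : ℝ} (hL : PolLimitExists F j ℰ ρ bV)
    (hK : ∀ z, ∀ᶠ K in atTop, |polWindow F K j (ℰ K) ρ bV μ ν z| ≤ C * Real.exp (-δ₁ * l1 z)) :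
    Decay510 (polLimit F j ℰ ρ bV μ ν) C δ₁ := fun z =>
  le_of_tendsto ((tendsto_polLimit F j ℰ ρ bV hL μ ν z).abs) (hK z)

/-- (R2) ⟹ (R1): fundamental-domain bounds are eventual bounds (the tori grow). [cite: Balaban1987RG1, (5.10) p.293 and (1.21) p.264] -/
private theorem eventually_bound_of_fundamentalDomain (F : T4Family) (j : ℕ) (ℰ : (K : ℕ) → (Fin (F.P K).d → Site (F.P K) j → 𝔄) → ℝ)
    (ρ : V →L[ℝ] 𝔄) (bV : Module.Basis ι ℝ V) (μ ν : Fin 4) (b : (Fin 4 → ℤ) → ℝ)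
    (h : ∀ K (z : Fin 4 → ℤ), (∀ i, 2 * |z i| < ((F.P K).sitesPerDir j : ℤ)) → |polWindow F K j (ℰ K) ρ bV μ ν z| ≤ b z)
    (z : Fin 4 → ℤ) : ∀ᶠ K in atTop, |polWindow F K j (ℰ K) ρ bV μ ν z| ≤ b z := by
  have ht : Tendsto (fun K => ((F.P K).sitesPerDir j : ℤ)) atTop atTop :=
    tendsto_natCast_atTop_atTop.comp (sitesPerDir_tendsto_atTop F j)
  have hall : ∀ᶠ K in atTop, ∀ i, 2 * |z i| < ((F.P K).sitesPerDir j : ℤ) :=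
    eventually_all.mpr fun i => ht.eventually_gt_atTop (2 * |z i|)
  exact hall.mono fun K hK => h K z hK

/-- (R1′) limits inherit eventual weighted-moment bounds (Fatou for sums, with summability). [cite: Balaban1987RG1, (1.21)–(1.22) p.264] -/
private theorem abs_secondMoment_polLimit_le_of_eventually (F : T4Family) (j : ℕ) (ℰ : (K : ℕ) → (Fin (F.P K).d → Site (F.P K) j → 𝔄) → ℝ)
    (ρ : V →L[ℝ] 𝔄) (bV : Module.Basis ι ℝ V) (μ ν : Fin 4) {M : ℝ} (hL : PolLimitExists F j ℰ ρ bV)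
    (hM : ∀ S : Finset (Fin 4 → ℤ), ∀ᶠ K in atTop, ∑ z ∈ S, |polWindow F K j (ℰ K) ρ bV μ ν z * (z μ : ℝ) * (z ν : ℝ)| ≤ M) :
    Summable (fun z : Fin 4 → ℤ => polLimit F j ℰ ρ bV μ ν z * (z μ : ℝ) * (z ν : ℝ)) ∧
      |B12Beta.secondMoment (polLimit F j ℰ ρ bV) μ ν| ≤ M := by
  set f : (Fin 4 → ℤ) → ℝ := fun z => polLimit F j ℰ ρ bV μ ν z * (z μ : ℝ) * (z ν : ℝ) with hf
  have hS : ∀ S : Finset (Fin 4 → ℤ), ∑ z ∈ S, |f z| ≤ M := by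
    intro S
    have ht : Tendsto (fun K => ∑ z ∈ S, |polWindow F K j (ℰ K) ρ bV μ ν z * (z μ : ℝ) * (z ν : ℝ)|) atTop
        (𝓝 (∑ z ∈ S, |f z|)) := by
      refine tendsto_finsetSum S fun z _ => ?_
      exact (((tendsto_polLimit F j ℰ ρ bV hL μ ν z).mul_const _).mul_const _).abs
    exact le_of_tendsto ht (hM S)
  have habs : Summable fun z => |f z| := summable_of_sum_le (fun z => abs_nonneg _) hS
  have hsum : Summable f := habs.of_abs
  refine ⟨hsum, ?_⟩
  have h1 : |∑' z, f z| ≤ ∑' z, |f z| := by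
    have := norm_tsum_le_tsum_norm (f := f) (by simpa [Real.norm_eq_abs] using habs)
    simpa [Real.norm_eq_abs] using this
  exact h1.trans (habs.tsum_le_of_sum_le hS)

/-- (R2′) ⟹ (R1′): partial-sum bounds inside the fundamental windows hold, for each fixed finite `S`, for all large `K`. [cite: Balaban1987RG1, (1.21)–(1.22) p.264] -/
private theorem eventually_sumBound_of_fundamentalDomain (F : T4Family) (j : ℕ) (ℰ : (K : ℕ) → (Fin (F.P K).d → Site (F.P K) j → 𝔄) → ℝ)
    (ρ : V →L[ℝ] 𝔄) (bV : Module.Basis ι ℝ V) (μ ν : Fin 4) {M : ℝ}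
    (h : ∀ K (S : Finset (Fin 4 → ℤ)), (∀ z ∈ S, ∀ i, 2 * |z i| < ((F.P K).sitesPerDir j : ℤ)) →
      ∑ z ∈ S, |polWindow F K j (ℰ K) ρ bV μ ν z * (z μ : ℝ) * (z ν : ℝ)| ≤ M)
    (S : Finset (Fin 4 → ℤ)) :
    ∀ᶠ K in atTop, ∑ z ∈ S, |polWindow F K j (ℰ K) ρ bV μ ν z * (z μ : ℝ) * (z ν : ℝ)| ≤ M := by
  have ht : Tendsto (fun K => ((F.P K).sitesPerDir j : ℤ)) atTop atTop :=
    tendsto_natCast_atTop_atTop.comp (sitesPerDir_tendsto_atTop F j)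
  have hall : ∀ᶠ K in atTop, ∀ z ∈ S, ∀ i, 2 * |z i| < ((F.P K).sitesPerDir j : ℤ) := by
    refine S.eventually_all.mpr fun z _ => ?_
    exact eventually_all.mpr fun i => ht.eventually_gt_atTop (2 * |z i|)
  exact hall.mono fun K hK => h K S hK

end Repair

/-! ## §2  θ-generic: the finite-volume faces ⟹ `|β₁₃ᴬˣ(θ)| ≤ β′` on `]0, γ₀]` (new public statements, |·|-form) -/

section AtTheta

variable (F : T4Family) (N : ℕ) [NeZero N] (θ : Stage13Params F N)

/-- On a box history of the member's own window the RE-CENTRED β of record IS (1.22) of the (1.21) `limUnder` kernel of the re-centred merged term (unfolding; the Ax twin of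
k0-s3-w2's `K0Stub3FinVolPeriodicity.betaOfRecord₁₃_eq_secondMoment_of_mem`, via `Record13Ax.betaOfRecord₁₃Ax_eq_betaOfRecord₈Tχ` + def-B's `betaOfMerged_of_mem`).
[cite: Balaban1987RG1, (1.20)–(1.22) p.264, (2.9) p.266 (bookkeeping)] -/
theorem betaOfRecord₁₃Ax_eq_secondMoment_of_mem {k : ℕ} {v : Fin (k + 1) → ℝ} (hv : v ∈ Box θ.γ k) :
    betaOfRecord₁₃Ax F N θ k v =
      (letI := θ.instVβ₁; letI := θ.instVβ₂; letI := θ.instιβ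
       B12Beta.secondMoment
         (polLimit F (k + 1) (fun K => mergedTermFamilyMatT F N (TβOfRecord₁₃ F N) (chiβOfRecord₁₃Ax F N θ) θ.εbg k v K) θ.ρ8 θ.bV) 0 1) := by
  letI := θ.instVβ₁; letI := θ.instVβ₂; letI := θ.instιβ
  rw [betaOfRecord₁₃Ax_eq_betaOfRecord₈Tχ]
  exact betaOfMerged_of_mem _ _ _ hv

/-- **★★ THE FINITE-VOLUME FACE, uniform eventual form ⟹ `|β₁₃ᴬˣ(θ)_{k+1}(v)| ≤ β′₅₁₀(C, δ₁)`** on `]0, γ₀]` (`γ₀ ≤ θ.γ`, `0 < δ₁`): W1's box limit letter `PolLimitsExistBox … γ₀` for the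
RE-CENTRED merged term of record (the printed limit (1.21) EXISTS at every history of `]0, γ₀]^{k+1}`) AND ONE pair `(C, δ₁)` with K-EVENTUAL bounds `|Π_K(v; z)| ≤ C e^{−δ₁|z|₁}` on its windowed
finite-torus kernels, every level and box history (`β′₅₁₀ = C·Σ_z |z|₁² e^{−δ₁|z|₁}`, b12 `secondMoment_abs_le_of_decay510`).  CONDITIONAL; nothing asserted. [cite: Balaban1987RG1, (1.20)–(1.22) p.264, (5.10) p.293, (5.42) p.297] -/
theorem abs_betaOfRecord₁₃Ax_le_of_uniformEventualDecayOnBox {γ₀ C δ₁ : ℝ} (hle : γ₀ ≤ θ.γ) (hδ : 0 < δ₁)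
    (hL : letI := θ.instVβ₁; letI := θ.instVβ₂; letI := θ.instιβ
      PolLimitsExistBox F (mergedTermFamilyMatT F N (TβOfRecord₁₃ F N) (chiβOfRecord₁₃Ax F N θ) θ.εbg) θ.ρ8 θ.bV γ₀)
    (hD : letI := θ.instVβ₁; letI := θ.instVβ₂; letI := θ.instιβ
      ∀ k (v : Fin (k + 1) → ℝ), v ∈ Box γ₀ k → ∀ z, ∀ᶠ K in atTop,
        |polWindow F K (k + 1) (mergedTermFamilyMatT F N (TβOfRecord₁₃ F N) (chiβOfRecord₁₃Ax F N θ) θ.εbg k v K) θ.ρ8 θ.bV 0 1 z| ≤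
          C * Real.exp (-δ₁ * l1 z))
    (k : ℕ) (v : Fin (k + 1) → ℝ) (hv : v ∈ Box γ₀ k) : |betaOfRecord₁₃Ax F N θ k v| ≤ betaPrime510 4 C δ₁ := by
  letI := θ.instVβ₁; letI := θ.instVβ₂; letI := θ.instιβ
  rw [betaOfRecord₁₃Ax_eq_secondMoment_of_mem F N θ (box_mono_of_le hle hv)]
  have hdec := decay510_polLimit_of_eventually F (k + 1)
    (fun K => mergedTermFamilyMatT F N (TβOfRecord₁₃ F N) (chiβOfRecord₁₃Ax F N θ) θ.εbg k v K) θ.ρ8 θ.bV 0 1 (hL k v hv) (hD k v hv)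
  exact (secondMoment_abs_le_of_decay510 hδ hdec).2

/-- **★★ THE FINITE-VOLUME FACE, fundamental-domain form** (print's torus reading of (5.10): ONE pair `(C, δ₁ > 0)` bounding, for EVERY `K`, the windowed kernel on the centred
fundamental window `2|z_i| < 2L^{m+K−k−1}` of `T^{(k+1)}`, every level and box history of `]0, γ₀]`) + W1's box limit letter ⟹ the same bound.  CONDITIONAL; nothing asserted.
[cite: Balaban1987RG1, (1.20)–(1.22) p.264, (5.10) p.293, (5.42) p.297] -/
theorem abs_betaOfRecord₁₃Ax_le_of_fundamentalDomainDecayOnBox {γ₀ C δ₁ : ℝ} (hle : γ₀ ≤ θ.γ) (hδ : 0 < δ₁)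
    (hL : letI := θ.instVβ₁; letI := θ.instVβ₂; letI := θ.instιβ
      PolLimitsExistBox F (mergedTermFamilyMatT F N (TβOfRecord₁₃ F N) (chiβOfRecord₁₃Ax F N θ) θ.εbg) θ.ρ8 θ.bV γ₀)
    (hD : letI := θ.instVβ₁; letI := θ.instVβ₂; letI := θ.instιβ
      ∀ k (v : Fin (k + 1) → ℝ), v ∈ Box γ₀ k → ∀ K (z : Fin 4 → ℤ), (∀ i, 2 * |z i| < ((F.P K).sitesPerDir (k + 1) : ℤ)) →
        |polWindow F K (k + 1) (mergedTermFamilyMatT F N (TβOfRecord₁₃ F N) (chiβOfRecord₁₃Ax F N θ) θ.εbg k v K) θ.ρ8 θ.bV 0 1 z| ≤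
          C * Real.exp (-δ₁ * l1 z))
    (k : ℕ) (v : Fin (k + 1) → ℝ) (hv : v ∈ Box γ₀ k) : |betaOfRecord₁₃Ax F N θ k v| ≤ betaPrime510 4 C δ₁ := by
  letI := θ.instVβ₁; letI := θ.instVβ₂; letI := θ.instιβ
  refine abs_betaOfRecord₁₃Ax_le_of_uniformEventualDecayOnBox F N θ hle hδ hL (fun k v hv => ?_) k v hv
  exact eventually_bound_of_fundamentalDomain F (k + 1)
    (fun K => mergedTermFamilyMatT F N (TβOfRecord₁₃ F N) (chiβOfRecord₁₃Ax F N θ) θ.εbg k v K) θ.ρ8 θ.bV 0 1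
    (fun z => C * Real.exp (-δ₁ * l1 z)) (hD k v hv)

/-- **★★ THE FINITE-VOLUME FACE, weighted-moment form ⟹ `|β₁₃ᴬˣ(θ)_{k+1}(v)| ≤ M`** on `]0, γ₀]`: W1's box limit letter + K-EVENTUAL bounds `M` on the partial sums over each fixed
finite `S ⊂ ℤ⁴` of `|Π_K(v; z) z₀ z₁|` ((1.22) of the limit converges absolutely by Fatou for sums).  CONDITIONAL; nothing asserted. [cite: Balaban1987RG1, (1.20)–(1.22) p.264] -/
theorem abs_betaOfRecord₁₃Ax_le_of_eventualAbsMomentOnBox {γ₀ M : ℝ} (hle : γ₀ ≤ θ.γ)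
    (hL : letI := θ.instVβ₁; letI := θ.instVβ₂; letI := θ.instιβ
      PolLimitsExistBox F (mergedTermFamilyMatT F N (TβOfRecord₁₃ F N) (chiβOfRecord₁₃Ax F N θ) θ.εbg) θ.ρ8 θ.bV γ₀)
    (hM : letI := θ.instVβ₁; letI := θ.instVβ₂; letI := θ.instιβ
      ∀ k (v : Fin (k + 1) → ℝ), v ∈ Box γ₀ k → ∀ S : Finset (Fin 4 → ℤ), ∀ᶠ K in atTop,
        ∑ z ∈ S, |polWindow F K (k + 1) (mergedTermFamilyMatT F N (TβOfRecord₁₃ F N) (chiβOfRecord₁₃Ax F N θ) θ.εbg k v K) θ.ρ8 θ.bV 0 1 z *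
          (z 0 : ℝ) * (z 1 : ℝ)| ≤ M)
    (k : ℕ) (v : Fin (k + 1) → ℝ) (hv : v ∈ Box γ₀ k) : |betaOfRecord₁₃Ax F N θ k v| ≤ M := by
  letI := θ.instVβ₁; letI := θ.instVβ₂; letI := θ.instιβ
  rw [betaOfRecord₁₃Ax_eq_secondMoment_of_mem F N θ (box_mono_of_le hle hv)]
  exact (abs_secondMoment_polLimit_le_of_eventually F (k + 1)
    (fun K => mergedTermFamilyMatT F N (TβOfRecord₁₃ F N) (chiβOfRecord₁₃Ax F N θ) θ.εbg k v K) θ.ρ8 θ.bV 0 1 (hL k v hv) (hM k v hv)).2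

/-- The fundamental-domain moment currency pays the eventual one (each fixed finite `S` sits in the fundamental window for all large `K`).  Bookkeeping. [cite: Balaban1987RG1, (1.21)–(1.22) p.264] -/
theorem abs_betaOfRecord₁₃Ax_le_of_fundamentalDomainAbsMomentOnBox {γ₀ M : ℝ} (hle : γ₀ ≤ θ.γ)
    (hL : letI := θ.instVβ₁; letI := θ.instVβ₂; letI := θ.instιβ
      PolLimitsExistBox F (mergedTermFamilyMatT F N (TβOfRecord₁₃ F N) (chiβOfRecord₁₃Ax F N θ) θ.εbg) θ.ρ8 θ.bV γ₀)
    (hM : letI := θ.instVβ₁; letI := θ.instVβ₂; letI := θ.instιβ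
      ∀ k (v : Fin (k + 1) → ℝ), v ∈ Box γ₀ k → ∀ K (S : Finset (Fin 4 → ℤ)), (∀ z ∈ S, ∀ i, 2 * |z i| < ((F.P K).sitesPerDir (k + 1) : ℤ)) →
        ∑ z ∈ S, |polWindow F K (k + 1) (mergedTermFamilyMatT F N (TβOfRecord₁₃ F N) (chiβOfRecord₁₃Ax F N θ) θ.εbg k v K) θ.ρ8 θ.bV 0 1 z *
          (z 0 : ℝ) * (z 1 : ℝ)| ≤ M)
    (k : ℕ) (v : Fin (k + 1) → ℝ) (hv : v ∈ Box γ₀ k) : |betaOfRecord₁₃Ax F N θ k v| ≤ M := by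
  letI := θ.instVβ₁; letI := θ.instVβ₂; letI := θ.instιβ
  refine abs_betaOfRecord₁₃Ax_le_of_eventualAbsMomentOnBox F N θ hle hL (fun k v hv S => ?_) k v hv
  exact eventually_sumBound_of_fundamentalDomain F (k + 1)
    (fun K => mergedTermFamilyMatT F N (TβOfRecord₁₃ F N) (chiβOfRecord₁₃Ax F N θ) θ.εbg k v K) θ.ρ8 θ.bV 0 1 (hM k v hv) S

end AtTheta

/-! ## §3  At the print-regime Z3 window members: a finite-volume face per radius ⟹ THE TOKEN-FREE CORE of the V24 stub-3ᴬ′ᴮ text -/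

section ZB

variable (F : T4Family)

/-- **★★ THE FUNDAMENTAL-DOMAIN FACE AT A WINDOW MEMBER, PER RADIUS ⟹ THE TOKEN-FREE CORE**: for every `a₀ > 0` SOME `γ₀ ∈ ]0, ½]`, `ε₂₉ > 0`, letters, a pair `(C, δ₁ > 0)`
such that at `θ := θ₁₃ᶜᶜᴹᵂᶻᴮ·ᴬˣ(j; γ₀; a₀; ε₀, ε₂₉; B₃, B₃′, a₀, a₁; Efl, logz)`: (L) W1's box limit letter `PolLimitsExistBox … γ₀` for the RE-CENTRED merged term of record, and (FD) for every `K` the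
windowed finite-torus kernel obeys `|Π_K(v; z)| ≤ C e^{−δ₁|z|₁}` on the centred fundamental window of `T^{(k+1)}`, every level and box history of `]0, γ₀]` ⟹ the token-free core
(§2 then `abs_le`, then the window edition).  CONDITIONAL on (L) ∧ (FD) (NODE O's torus analysis, [I] (1.7) ∕ §5; displayed, inhabited nowhere). [cite: Balaban1987RG1, Thm 1 p.259, (1.20)–(1.22) p.264, (5.10) p.293, §1 p.264; Balaban1989LargeFieldII, p.355] -/
theorem tokenFreeZBAx_of_fundamentalDomainFaceAtZB
    (h : ∀ a₀ : ℝ, 0 < a₀ → ∃ (γ₀ ε₂₉ : ℝ) (j : ℕ) (ε₀ B₃ B₃' a₁ : ℝ) (Efl logz : B12.RunParams → ℕ → ℝ) (C δ₁ : ℝ), 0 < γ₀ ∧ γ₀ ≤ 1 / 2 ∧ 0 < ε₂₉ ∧ 0 < δ₁ ∧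
      letI θ := theta13OfThm1CCMWZBAx F 2 j γ₀ a₀ ε₀ ε₂₉ B₃ B₃' a₀ a₁ Efl logz
      letI := θ.instVβ₁; letI := θ.instVβ₂; letI := θ.instιβ
      PolLimitsExistBox F (mergedTermFamilyMatT F 2 (TβOfRecord₁₃ F 2) (chiβOfRecord₁₃Ax F 2 θ) θ.εbg) θ.ρ8 θ.bV γ₀ ∧
      ∀ k (v : Fin (k + 1) → ℝ), v ∈ Box γ₀ k → ∀ K (z : Fin 4 → ℤ), (∀ i, 2 * |z i| < ((F.P K).sitesPerDir (k + 1) : ℤ)) →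
        |polWindow F K (k + 1) (mergedTermFamilyMatT F 2 (TβOfRecord₁₃ F 2) (chiβOfRecord₁₃Ax F 2 θ) θ.εbg k v K) θ.ρ8 θ.bV 0 1 z| ≤ C * Real.exp (-δ₁ * l1 z)) :
    ∀ a₀ : ℝ, 0 < a₀ → ∃ γ₀ ε₂₉ β' : ℝ, 0 < γ₀ ∧ 0 < ε₂₉ ∧ ∀ (j : ℕ) (ε₀ B₃ B₃' a₁ : ℝ),
      BetaLowerH (-β') γ₀ (betaOfRecord₁₃Ax F 2 (theta13OfThm1CCMWZBAx F 2 j (1 / 2) a₀ ε₀ ε₂₉ B₃ B₃' a₀ a₁ (fun _ _ => 0) (fun _ _ => 0))) ∧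
      BetaUpperH β' γ₀ (betaOfRecord₁₃Ax F 2 (theta13OfThm1CCMWZBAx F 2 j (1 / 2) a₀ ε₀ ε₂₉ B₃ B₃' a₀ a₁ (fun _ _ => 0) (fun _ _ => 0))) := by
  refine tokenFreeZBAx_of_windowBoxAtZB F fun a₀ ha₀ => ?_
  obtain ⟨γ₀, ε₂₉, j, ε₀, B₃, B₃', a₁, Efl, logz, C, δ₁, hγ₀, hγhalf, hε', hδ, hL, hD⟩ := h a₀ ha₀
  have hγθ : γ₀ ≤ (theta13OfThm1CCMWZBAx F 2 j γ₀ a₀ ε₀ ε₂₉ B₃ B₃' a₀ a₁ Efl logz).γ := by rw [theta13OfThm1CCMWZBAx_γ]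
  have key := abs_betaOfRecord₁₃Ax_le_of_fundamentalDomainDecayOnBox F 2 _ hγθ hδ hL hD
  exact ⟨γ₀, ε₂₉, betaPrime510 4 C δ₁, j, ε₀, B₃, B₃', a₁, Efl, logz, hγ₀, hγhalf, hε',
    fun k v hv => (abs_le.mp (key k v hv)).1, fun k v hv => (abs_le.mp (key k v hv)).2⟩

/-- **★★ THE UNIFORM-EVENTUAL FACE AT A WINDOW MEMBER, PER RADIUS ⟹ THE TOKEN-FREE CORE** ((L) + K-EVENTUAL uniform bounds at the member).  CONDITIONAL. [cite: Balaban1987RG1, Thm 1 p.259, (1.20)–(1.22) p.264, (5.10) p.293; Balaban1989LargeFieldII, p.355] -/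
theorem tokenFreeZBAx_of_uniformEventualFaceAtZB
    (h : ∀ a₀ : ℝ, 0 < a₀ → ∃ (γ₀ ε₂₉ : ℝ) (j : ℕ) (ε₀ B₃ B₃' a₁ : ℝ) (Efl logz : B12.RunParams → ℕ → ℝ) (C δ₁ : ℝ), 0 < γ₀ ∧ γ₀ ≤ 1 / 2 ∧ 0 < ε₂₉ ∧ 0 < δ₁ ∧
      letI θ := theta13OfThm1CCMWZBAx F 2 j γ₀ a₀ ε₀ ε₂₉ B₃ B₃' a₀ a₁ Efl logz
      letI := θ.instVβ₁; letI := θ.instVβ₂; letI := θ.instιβ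
      PolLimitsExistBox F (mergedTermFamilyMatT F 2 (TβOfRecord₁₃ F 2) (chiβOfRecord₁₃Ax F 2 θ) θ.εbg) θ.ρ8 θ.bV γ₀ ∧
      ∀ k (v : Fin (k + 1) → ℝ), v ∈ Box γ₀ k → ∀ z, ∀ᶠ K in atTop,
        |polWindow F K (k + 1) (mergedTermFamilyMatT F 2 (TβOfRecord₁₃ F 2) (chiβOfRecord₁₃Ax F 2 θ) θ.εbg k v K) θ.ρ8 θ.bV 0 1 z| ≤ C * Real.exp (-δ₁ * l1 z)) :
    ∀ a₀ : ℝ, 0 < a₀ → ∃ γ₀ ε₂₉ β' : ℝ, 0 < γ₀ ∧ 0 < ε₂₉ ∧ ∀ (j : ℕ) (ε₀ B₃ B₃' a₁ : ℝ),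
      BetaLowerH (-β') γ₀ (betaOfRecord₁₃Ax F 2 (theta13OfThm1CCMWZBAx F 2 j (1 / 2) a₀ ε₀ ε₂₉ B₃ B₃' a₀ a₁ (fun _ _ => 0) (fun _ _ => 0))) ∧
      BetaUpperH β' γ₀ (betaOfRecord₁₃Ax F 2 (theta13OfThm1CCMWZBAx F 2 j (1 / 2) a₀ ε₀ ε₂₉ B₃ B₃' a₀ a₁ (fun _ _ => 0) (fun _ _ => 0))) := by
  refine tokenFreeZBAx_of_windowBoxAtZB F fun a₀ ha₀ => ?_
  obtain ⟨γ₀, ε₂₉, j, ε₀, B₃, B₃', a₁, Efl, logz, C, δ₁, hγ₀, hγhalf, hε', hδ, hL, hD⟩ := h a₀ ha₀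
  have hγθ : γ₀ ≤ (theta13OfThm1CCMWZBAx F 2 j γ₀ a₀ ε₀ ε₂₉ B₃ B₃' a₀ a₁ Efl logz).γ := by rw [theta13OfThm1CCMWZBAx_γ]
  have key := abs_betaOfRecord₁₃Ax_le_of_uniformEventualDecayOnBox F 2 _ hγθ hδ hL hD
  exact ⟨γ₀, ε₂₉, betaPrime510 4 C δ₁, j, ε₀, B₃, B₃', a₁, Efl, logz, hγ₀, hγhalf, hε',
    fun k v hv => (abs_le.mp (key k v hv)).1, fun k v hv => (abs_le.mp (key k v hv)).2⟩

/-- **★★ THE MOMENT FACE AT A WINDOW MEMBER, PER RADIUS ⟹ THE TOKEN-FREE CORE** ((L) + eventual weighted-moment bounds `M` at the member; `β′ := M`).  CONDITIONAL. [cite: Balaban1987RG1, Thm 1 p.259, (1.20)–(1.22) p.264; Balaban1989LargeFieldII, p.355] -/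
theorem tokenFreeZBAx_of_momentFaceAtZB
    (h : ∀ a₀ : ℝ, 0 < a₀ → ∃ (γ₀ ε₂₉ : ℝ) (j : ℕ) (ε₀ B₃ B₃' a₁ : ℝ) (Efl logz : B12.RunParams → ℕ → ℝ) (M : ℝ), 0 < γ₀ ∧ γ₀ ≤ 1 / 2 ∧ 0 < ε₂₉ ∧
      letI θ := theta13OfThm1CCMWZBAx F 2 j γ₀ a₀ ε₀ ε₂₉ B₃ B₃' a₀ a₁ Efl logz
      letI := θ.instVβ₁; letI := θ.instVβ₂; letI := θ.instιβ
      PolLimitsExistBox F (mergedTermFamilyMatT F 2 (TβOfRecord₁₃ F 2) (chiβOfRecord₁₃Ax F 2 θ) θ.εbg) θ.ρ8 θ.bV γ₀ ∧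
      ∀ k (v : Fin (k + 1) → ℝ), v ∈ Box γ₀ k → ∀ S : Finset (Fin 4 → ℤ), ∀ᶠ K in atTop,
        ∑ z ∈ S, |polWindow F K (k + 1) (mergedTermFamilyMatT F 2 (TβOfRecord₁₃ F 2) (chiβOfRecord₁₃Ax F 2 θ) θ.εbg k v K) θ.ρ8 θ.bV 0 1 z * (z 0 : ℝ) * (z 1 : ℝ)| ≤ M) :
    ∀ a₀ : ℝ, 0 < a₀ → ∃ γ₀ ε₂₉ β' : ℝ, 0 < γ₀ ∧ 0 < ε₂₉ ∧ ∀ (j : ℕ) (ε₀ B₃ B₃' a₁ : ℝ),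
      BetaLowerH (-β') γ₀ (betaOfRecord₁₃Ax F 2 (theta13OfThm1CCMWZBAx F 2 j (1 / 2) a₀ ε₀ ε₂₉ B₃ B₃' a₀ a₁ (fun _ _ => 0) (fun _ _ => 0))) ∧
      BetaUpperH β' γ₀ (betaOfRecord₁₃Ax F 2 (theta13OfThm1CCMWZBAx F 2 j (1 / 2) a₀ ε₀ ε₂₉ B₃ B₃' a₀ a₁ (fun _ _ => 0) (fun _ _ => 0))) := by
  refine tokenFreeZBAx_of_windowBoxAtZB F fun a₀ ha₀ => ?_
  obtain ⟨γ₀, ε₂₉, j, ε₀, B₃, B₃', a₁, Efl, logz, M, hγ₀, hγhalf, hε', hL, hM⟩ := h a₀ ha₀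
  have hγθ : γ₀ ≤ (theta13OfThm1CCMWZBAx F 2 j γ₀ a₀ ε₀ ε₂₉ B₃ B₃' a₀ a₁ Efl logz).γ := by rw [theta13OfThm1CCMWZBAx_γ]
  have key := abs_betaOfRecord₁₃Ax_le_of_eventualAbsMomentOnBox F 2 _ hγθ hL hM
  exact ⟨γ₀, ε₂₉, M, j, ε₀, B₃, B₃', a₁, Efl, logz, hγ₀, hγhalf, hε',
    fun k v hv => (abs_le.mp (key k v hv)).1, fun k v hv => (abs_le.mp (key k v hv)).2⟩

end ZB

end Summit.QuantumFields.YangMills.Theorems.K0V23Stub3FinVolSuppliersAx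

end
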